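import Summits.CriticalPhenomena.PercolationContinuityZ3.Theorems.PercNearOneGluingNoHeavyPcintUFibBipSum
import HarnessLib

/-!
# PCINT lane, T-fibre route PHASE 2, step (5B): the tail tables of complete bipartite fibres, checked over `ℚ`

Cell `prim-pcint`, seat `prim-pcint-1` (gen 12); memo `run/shared/lean/prim/pcint/T-FIBRE-ROUTE.md` (PHASE 2).

With the closed form `UFib.cf` (`…PcintUFibBipSum.lean`), the tail table of `UFib.dominating` for the complete bipartite
fibre with sides `nA`, `nB` at `(p, s)` is the finite family of rational inequalities

  `cf nA nB ha hb p 1 · P(Bin(k,s) ≥ j) ≤ cf nA nB ha hb p (u ↦ P(Bin(k, 1-(1-p)^u) ≥ j))`,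
  `ha ≤ nA`, `hb ≤ nB`, `k ≤ 5`, `1 ≤ j ≤ k`,

decided by the Boolean program `UFib.checkBip nA nB p s` (exact rational arithmetic, evaluated by the kernel with
`decide` in the instance files) and transported to `ℝ` (`UFib.table_of_checkBip`).
-/

namespace Summit.CriticalPhenomena.PercolationContinuityZ3.Theorems.Pcint

namespace UFib

open Finset AdaptDom

/-! ### Casting the closed form from `ℚ` to `ℝ` -/

/-- `bt` commutes with the cast `ℚ → ℝ`. -/
theorem bt_cast (k : ℕ) (r : ℚ) (j : ℕ) : ((bt k r j : ℚ) : ℝ) = bt k (r : ℝ) j := by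
  unfold bt
  rw [Rat.cast_sum]
  refine Finset.sum_congr rfl fun ℓ _ => ?_
  rw [apply_ite ((↑) : ℚ → ℝ)]
  push_cast
  rfl

/-- `cf` commutes with the cast `ℚ → ℝ`. -/
theorem cf_cast (nA nB ha hb : ℕ) (p : ℚ) (φ : ℕ → ℚ) :
    ((cf nA nB ha hb p φ : ℚ) : ℝ) = cf nA nB ha hb (p : ℝ) (fun u => ((φ u : ℚ) : ℝ)) := by
  unfold cf
  simp only [Rat.cast_add, Rat.cast_mul, Rat.cast_sum, Rat.cast_pow, Rat.cast_sub, Rat.cast_one,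
    apply_ite ((↑) : ℚ → ℝ), Rat.cast_natCast, Rat.cast_zero]

/-! ### The Boolean check -/

/-- One tail inequality, decided over `ℚ`. -/
def tailOK (nA nB ha hb k j : ℕ) (p s : ℚ) : Bool :=
  decide (cf nA nB ha hb p (fun _ => 1) * bt k s j ≤ cf nA nB ha hb p (fun u => bt k (1 - (1 - p) ^ u) j))

/-- One cell of the tail table check: the type `(ha, hb)`, all `k ≤ 5`, `1 ≤ j ≤ k`. -/
def checkCell (nA nB ha hb : ℕ) (p s : ℚ) : Bool :=
  (List.range 6).all fun k => (List.range (k + 1)).all fun j => (j == 0) || tailOK nA nB ha hb k j p s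

/-- One row of the tail table check: the types `(ha, hb)`, `hb ≤ nB`. -/
def checkRow (nA nB ha : ℕ) (p s : ℚ) : Bool := (List.range (nB + 1)).all fun hb => checkCell nA nB ha hb p s

/-- A band of cells of one row: the types `(ha, hb)` with `lo ≤ hb ≤ hi` (the others are skipped). -/
def checkCells (nA nB ha lo hi : ℕ) (p s : ℚ) : Bool :=
  (List.range (nB + 1)).all fun hb => decide (hb < lo) || (decide (hi < hb) || checkCell nA nB ha hb p s)

/-- A row check from two bands of cells (used to keep each kernel computation small). -/
theorem checkRow_of_bands {nA nB ha m : ℕ} {p s : ℚ} (h1 : checkCells nA nB ha 0 m p s = true)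
    (h2 : checkCells nA nB ha (m + 1) nB p s = true) : checkRow nA nB ha p s = true := by
  unfold checkRow
  unfold checkCells at h1 h2
  simp only [List.all_eq_true, List.mem_range, Bool.or_eq_true, decide_eq_true_eq] at h1 h2 ⊢
  intro hb hhb
  by_cases hm : hb ≤ m
  · rcases h1 hb hhb with h | h | h
    · omega
    · omega
    · exact h
  · rcases h2 hb hhb with h | h | h
    · omega
    · omega
    · exact h

/-- A row check from its cells. -/
theorem checkRow_of_cells {nA nB ha : ℕ} {p s : ℚ} (h : ∀ hb, hb ≤ nB → checkCell nA nB ha hb p s = true) :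
    checkRow nA nB ha p s = true := by
  unfold checkRow
  simp only [List.all_eq_true, List.mem_range]
  intro hb hhb
  exact h hb (by omega)

/-- **The tail table check** for the complete bipartite fibre with sides `nA`, `nB` at `(p, s)`: all types
`ha ≤ nA`, `hb ≤ nB`, all `k ≤ 5`, `1 ≤ j ≤ k`. -/
def checkBip (nA nB : ℕ) (p s : ℚ) : Bool := (List.range (nA + 1)).all fun ha => checkRow nA nB ha p s

/-- The table check from its rows (the rows are decided one by one by the kernel in the instance files). -/
theorem checkBip_of_rows {nA nB : ℕ} {p s : ℚ} (h : ∀ ha, ha ≤ nA → checkRow nA nB ha p s = true) :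
    checkBip nA nB p s = true := by
  unfold checkBip
  simp only [List.all_eq_true, List.mem_range]
  intro ha hha
  exact h ha (by omega)

/-- A passed check gives every tail inequality over `ℝ` (in terms of `cf` and `AdaptDom.binTail`). -/
theorem tail_of_checkBip {nA nB : ℕ} {p s : ℚ} (h : checkBip nA nB p s = true)
    {ha hb k j : ℕ} (hha : ha ≤ nA) (hhb : hb ≤ nB) (hk : k ≤ 5) (hj1 : 1 ≤ j) (hjk : j ≤ k) :
    cf nA nB ha hb (p : ℝ) (fun _ => 1) * binTail k (s : ℝ) j ≤
      cf nA nB ha hb (p : ℝ) (fun u => binTail k (1 - (1 - (p : ℝ)) ^ u) j) := by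
  have h1 : tailOK nA nB ha hb k j p s = true := by
    unfold checkBip checkRow checkCell at h
    simp only [List.all_eq_true, List.mem_range] at h
    have := h ha (by omega) hb (by omega) k (by omega) j (by omega)
    rw [Bool.or_eq_true] at this
    rcases this with h0 | h0
    · have : j = 0 := by simpa using h0
      omega
    · exact h0
  have h2 := of_decide_eq_true h1
  have h3 := (Rat.cast_le (K := ℝ)).2 h2
  rw [Rat.cast_mul, cf_cast, cf_cast, bt_cast] at h3
  simp only [Rat.cast_one, bt_cast, Rat.cast_sub, Rat.cast_pow] at h3
  simpa only [bt_eq_binTail] using h3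

/-- **The tail table of `UFib.dominating` for `υB SA` from a passed check.** -/
theorem table_of_checkBip {Φ : Type*} [Fintype Φ] [DecidableEq Φ] (SA : Finset Φ) {p s : ℚ}
    (h : checkBip SA.card SAᶜ.card p s = true) :
    ∀ (H : Finset Φ) (k : ℕ), k ≤ 5 → ∀ j, 1 ≤ j → j ≤ k →
      (∑ x : Φ → Bool, wt (p : ℝ) x * (if meetsU x H = true then (1 : ℝ) else 0)) * binTail k (s : ℝ) j ≤
        ∑ x : Φ → Bool, wt (p : ℝ) x * (if meetsU x H = true then (1 : ℝ) else 0) *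
          binTail k (1 - (1 - (p : ℝ)) ^ (υB SA x H).card) j := by
  intro H k hk j hj1 hjk
  have e0 : ∑ x : Φ → Bool, wt (p : ℝ) x * (if meetsU x H = true then (1 : ℝ) else 0) =
      ∑ x : Φ → Bool, wt (p : ℝ) x * ((if meetsU x H = true then (1 : ℝ) else 0) * (fun _ => (1 : ℝ)) (υB SA x H).card) :=
    Finset.sum_congr rfl fun x _ => by simp
  have e1 : ∑ x : Φ → Bool, wt (p : ℝ) x * (if meetsU x H = true then (1 : ℝ) else 0) *
        binTail k (1 - (1 - (p : ℝ)) ^ (υB SA x H).card) j =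
      ∑ x : Φ → Bool, wt (p : ℝ) x * ((if meetsU x H = true then (1 : ℝ) else 0) *
        (fun u => binTail k (1 - (1 - (p : ℝ)) ^ u) j) (υB SA x H).card) :=
    Finset.sum_congr rfl fun x _ => by ring
  rw [e0, e1, sum_wt_meetsU_υB SA (p : ℝ) H (fun _ => (1 : ℝ)),
    sum_wt_meetsU_υB SA (p : ℝ) H (fun u => binTail k (1 - (1 - (p : ℝ)) ^ u) j)]
  exact tail_of_checkBip h (card_le_card inter_subset_left) (card_le_card inter_subset_left) hk hj1 hjk

/-- Sanity check and kernel-cost probe: the table of `K_{2,2}` at `p = 0.4143`, `s = 0.5001` passes. -/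
theorem checkBip_two : checkBip 2 2 (4143 / 10000) (5001 / 10000) = true := by decide +kernel

end UFib

end Summit.CriticalPhenomena.PercolationContinuityZ3.Theorems.Pcint
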